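import Mathlib
import HarnessLib
import Summits.NavierStokesRegularity.NavierStokesRegularity.Theorems.HalfSpaceWindowDoorCirculationCarryingRigidityConeSweeping
import Summits.NavierStokesRegularity.NavierStokesRegularity.Theorems.HalfSpaceWindowDoorCirculationCarryingRigidityConeSupportRigidity
import Summits.NavierStokesRegularity.NavierStokesRegularity.Theorems.HalfSpaceWindowDoorCirculationCarryingRigidityGaussExtremalCone
import Summits.NavierStokesRegularity.NavierStokesRegularity.Theorems.AxisTwistDoorAveragedConeLiouvilleCircleLimits

/-!
# Route `HalfSpaceWindowDoor`, crux `CirculationCarryingRigidity` (stmt-NavierStokesRegularity-25311) —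
# line `cone_sweep`, Step 4: THE CONE STRATUM OF THE TIME-ONLY CLASS IS DEAD FOR ALL `C`, `K`

LEAD ns-hsw-p1 g9 (cell pub-ns-dss), `--supports stmt-NavierStokesRegularity-25311 --as helper`; card `Cruxes/…/Lines/cone_sweep.md`.

**Theorem (`eq_zero_of_coned`).**  A door-class profile (`‖v(s)‖_∞ ≤ C/√(−s)`, continuity, unit-viscosity Oseen–Duhamel identity,
divergence-free slices) with `⟪curl v, e₃⟫ ≥ 0` and the cone `‖ω_h‖ ≤ K·ω₃` everywhere (`K ≥ 0`, ANY `C`) vanishes identically.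

Proof (the four steps of the line): let `S₀ = sup{Γ(r,z,s)}` over all discs and times (finite by the sweeping lemma,
`…ConeSweeping.circ_le_const_of_cone`).  If `S₀ = 0` every slice is saturated by the empty disc and `…ConeSupportRigidity.eq_zero_of_saturated`
applies.  Otherwise the sweeping lemma (`circ_le_sSup_of_cone`) turns near-maximal discs into near-maximal TUBE-BOUNDARY discs
`Γ(R₁√(−s_n), z_n, s_n) → S₀`, `R₁ = 4C(1+K)+1`; the Navier–Stokes zooms about `(0,0,z_n)` with `λ_n = √(−s_n)` stay in the class
(`isTypeIAncientMild_zoom`), keep the sign and the cone (`…GaussExtremalCone.cone_zoom`) and have `Γ_n(R₁, 0, −1) → S₀`, all discs `≤ S₀`;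
F3 (`exists_tendsto_of_isTypeIAncientMild_seq`) gives a coned closed-hemisphere door-class limit `W` with `Γ_W(R₁,0,−1) = S₀ ≥ Γ_W(r,z,−1)`
(`tendsto_circ`, `cone_lim`) — a SATURATED disc — so `W ≡ 0` by Step 3, contradicting `S₀ > 0`.
Corollaries: `inner_curl_e3_eq_zero_of_coned` (poloidal), `not_isBackwardSingularPoint_of_coned`, and LRT's spelling
`eq_zero_of_vorticity_cone_allC` (`‖ω‖ ≤ K'⟪ω,e₃⟫`, `K' ≥ 0` ⇒ `v ≡ 0`).  This supersedes the threshold row `…GaussExtremalCone` (`C(1+K) < 1`)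
and complements AxisTwistDoor's `averagedConeLiouville_holds` (LRT in the ENERGY class): here no energy hypothesis, conclusion Liouville.
WHAT THIS IS NOT: not a statement about Navier–Stokes regularity; door statements concern HYPOTHETICAL blow-up profiles (KNSS ancient mild
solutions); `HemisphereLiouvilleE3` itself (no cone) stays OPEN.  No item is closed by this file.
-/

noncomputable section

-- the summit and its single sub-problem share the name (CONVENTIONS §1), as in every Theorems file
set_option linter.dupNamespace false

namespace Summit.NavierStokesRegularity.NavierStokesRegularity.Theorems.HalfSpaceWindowDoorCirculationCarryingRigidityConeLiouville

open MeasureTheory Set Function Filter Topology InnerProductSpace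
open scoped RealInnerProductSpace InnerProductSpace
open Literature.Analysis Literature.Analysis.FluidPDE Literature.Analysis.UnboundedOperators
open Summit.NavierStokesRegularity.NavierStokesRegularity.Theses.HalfSpaceWindowDoor
open Summit.NavierStokesRegularity.NavierStokesRegularity.Theorems.HalfSpaceWindowDoorCirculationCarryingRigidityDefs
  (InDoorClass SignE3 e3)
open Summit.NavierStokesRegularity.NavierStokesRegularity.Theorems.AxisTwistDoorAveragedConeLiouvilleDefs (cylPt eT circ)
open Summit.NavierStokesRegularity.NavierStokesRegularity.Theorems.AveragedConeLiouville.CircMonotone (circ_zero)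
open Summit.NavierStokesRegularity.NavierStokesRegularity.Theorems.AveragedConeLiouville.CircleLimits (tendsto_circ)
open Summit.NavierStokesRegularity.NavierStokesRegularity.Theorems
  (exists_tendsto_of_isTypeIAncientMild_seq isTypeIAncientMild_zoom zoom_apply)
open Summit.NavierStokesRegularity.NavierStokesRegularity.Theorems.HalfSpaceWindowDoorCirculationCarryingRigidityGaussKernel (inner_e3_apply)
open Summit.NavierStokesRegularity.NavierStokesRegularity.Theorems.HalfSpaceWindowDoorCirculationCarryingRigidityGaussExtremal
  (inDoorClass_of_isTypeIAncientMild)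
open Summit.NavierStokesRegularity.NavierStokesRegularity.Theorems.HalfSpaceWindowDoorCirculationCarryingRigidityHorizontalVorticityFloor
  (tendsto_curl_of_tendsto_fderiv eq_zero_of_curl_parallel_slice)
open Summit.NavierStokesRegularity.NavierStokesRegularity.Theorems.PoloidalWindowDoorPoloidalWindowRigidityWindow
  (isTypeIAncientMild_of_class)
open Summit.NavierStokesRegularity.NavierStokesRegularity.Theorems.HalfSpaceWindowDoorCirculationCarryingRigidityGaussExtremalCone
  (cone_zoom cone_lim eq_zero_of_cone_of_apply_two_eq_zero)
open Summit.NavierStokesRegularity.NavierStokesRegularity.Theorems.HalfSpaceWindowDoorCirculationCarryingRigidityConeFluxSubsolution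
  (signE3_atd contDiff_one_slice tube_bddAbove)
open Summit.NavierStokesRegularity.NavierStokesRegularity.Theorems.HalfSpaceWindowDoorCirculationCarryingRigidityConeSweeping
  (circ_le_sSup_of_cone circ_le_const_of_cone)
open Summit.NavierStokesRegularity.NavierStokesRegularity.Theorems.HalfSpaceWindowDoorCirculationCarryingRigidityConeSupportRigidity
  (eq_zero_of_saturated)

variable {C : ℝ} {v : ℝ → EuclideanSpace ℝ (Fin 3) → EuclideanSpace ℝ (Fin 3)}

/-! ### Zooms about axis points and the axis circulation -/

/-- `cylPt 0 0 ζ + c • cylPt r θ z = cylPt (c r) θ (ζ + c z)`. -/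
theorem axisPt_add_smul_cylPt (ζ c r θ z : ℝ) : cylPt 0 0 ζ + c • cylPt r θ z = cylPt (c * r) θ (ζ + c * z) := by
  ext i
  fin_cases i <;> simp [cylPt] <;> ring

/-- **The axis circulation under the Navier–Stokes zoom about the axis point `(0,0,ζ)`**:
`Γ[c • v(c²·, (0,0,ζ) + c·)](r, z, s) = Γ[v](c r, ζ + c z, c² s)`. -/
theorem circ_zoom_axis (c ζ : ℝ) (u : ℝ → EuclideanSpace ℝ (Fin 3) → EuclideanSpace ℝ (Fin 3)) (r z s : ℝ) :
    circ (c • stPull (c ^ 2) c 0 (cylPt 0 0 ζ) u) r z s = circ u (c * r) (ζ + c * z) (c ^ 2 * s) := by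
  unfold circ
  refine intervalIntegral.integral_congr fun θ _ => ?_
  simp only [zoom_apply, axisPt_add_smul_cylPt, inner_smul_left, RCLike.conj_to_real]
  ring

/-- The circulation of the zero field vanishes. -/
theorem circ_eq_zero_of_slice_zero {u : ℝ → EuclideanSpace ℝ (Fin 3) → EuclideanSpace ℝ (Fin 3)} {s : ℝ} (hu : ∀ x, u s x = 0)
    (r z : ℝ) : circ u r z s = 0 := by
  unfold circ
  simp [hu]

/-! ### The theorem -/

/-- **THE CONE STRATUM IS DEAD (all `C`, `K`).**  A closed-hemisphere door-class profile whose vorticity lies everywhere in the cone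
`‖ω_h‖ ≤ K·ω₃` vanishes identically. -/
theorem eq_zero_of_coned (hv : InDoorClass C v) (hsign : SignE3 v) {K : ℝ} (hK : 0 ≤ K)
    (hcone : ∀ s < 0, ∀ x, Real.sqrt ((curl (v s) x 0) ^ 2 + (curl (v s) x 1) ^ 2) ≤ K * curl (v s) x 2) :
    ∀ t < 0, ∀ x, v t x = 0 := by
  have hA : IsTypeIAncientMild C v := isTypeIAncientMild_of_class hv.1 hv.2.1 hv.2.2.1 hv.2.2.2
  set R₁ : ℝ := 4 * (C * (1 + K)) + 1 with hR₁
  have hC : 0 ≤ C := hA.nonneg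
  have hR₁0 : 0 ≤ R₁ := by positivity
  -- the total set of circulations and its supremum `S₀`
  set Tot : Set ℝ := {m | ∃ s : ℝ, s < 0 ∧ ∃ r : ℝ, 0 ≤ r ∧ ∃ z : ℝ, m = circ v r z s} with hTot
  have hTotle : ∀ m ∈ Tot, m ≤ 2 * Real.pi * (R₁ * C) := by
    rintro m ⟨s, hs, r, hr, z, rfl⟩
    exact circ_le_const_of_cone hv hsign hK hcone hs hr z
  have hTotbdd : BddAbove Tot := ⟨_, hTotle⟩
  have hmem : ∀ s < 0, ∀ r : ℝ, 0 ≤ r → ∀ z, circ v r z s ∈ Tot := fun s hs r hr z => ⟨s, hs, r, hr, z, rfl⟩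
  have hTotne : Tot.Nonempty := ⟨_, hmem (-1) (by norm_num) 0 le_rfl 0⟩
  set S₀ : ℝ := sSup Tot with hS₀
  have hleS : ∀ s < 0, ∀ r : ℝ, 0 ≤ r → ∀ z, circ v r z s ≤ S₀ := fun s hs r hr z => le_csSup hTotbdd (hmem s hs r hr z)
  rcases le_or_gt S₀ 0 with hS | hS
  · -- every slice is saturated by the empty disc
    exact eq_zero_of_saturated hv hsign hK hcone (s₀ := -1) (by norm_num) (R := 0) (z₀ := 0) (S := 0) le_rfl (circ_zero (v := v) 0 (-1))
      fun r hr z => (hleS (-1) (by norm_num) r hr z).trans hS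
  -- `S₀ > 0`: near-maximal TUBE-BOUNDARY discs at some `(s_n, z_n)`
  exfalso
  have hnear : ∀ n : ℕ, ∃ p : ℝ × ℝ, p.1 < 0 ∧ S₀ - 1 / ((n : ℝ) + 1) < circ v (R₁ * Real.sqrt (-p.1)) p.2 p.1 := by
    intro n
    have hε : S₀ - 1 / ((n : ℝ) + 1) < S₀ := by
      have : (0 : ℝ) < 1 / ((n : ℝ) + 1) := by positivity
      linarith
    obtain ⟨m, ⟨s, hs, r, hr, z, rfl⟩, hm⟩ := exists_lt_of_lt_csSup hTotne hε
    -- the sweeping lemma at `s₁ = s`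
    have hsw := circ_le_sSup_of_cone hv hsign hK hcone hs le_rfl hr z
    obtain ⟨hTbdd, -⟩ := tube_bddAbove hv hR₁0 hs
    have hTne : {m' : ℝ | ∃ s' : ℝ, s' ≤ s ∧ ∃ z' : ℝ, m' = circ v (R₁ * Real.sqrt (-s')) z' s'}.Nonempty :=
      ⟨_, s, le_rfl, 0, rfl⟩
    obtain ⟨m', ⟨s', hs', z', rfl⟩, hm'⟩ := exists_lt_of_lt_csSup hTne (lt_of_lt_of_le hm hsw)
    exact ⟨(s', z'), lt_of_le_of_lt hs' hs, hm'⟩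
  choose p hp1 hp2 using hnear
  set sn : ℕ → ℝ := fun n => (p n).1 with hsn
  set zn : ℕ → ℝ := fun n => (p n).2 with hzn
  set lam : ℕ → ℝ := fun n => Real.sqrt (-sn n) with hlam
  have hlam0 : ∀ n, 0 < lam n := fun n => Real.sqrt_pos.2 (neg_pos.2 (hp1 n))
  have hlam2 : ∀ n, lam n ^ 2 = -sn n := fun n => Real.sq_sqrt (neg_pos.2 (hp1 n)).le
  -- the zooms about `(0,0,z_n)` with factor `λ_n = √(−s_n)`
  set w : ℕ → ℝ → EuclideanSpace ℝ (Fin 3) → EuclideanSpace ℝ (Fin 3) :=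
    fun n => lam n • stPull (lam n ^ 2) (lam n) 0 (cylPt 0 0 (zn n)) v with hw
  have hwcl : ∀ n, IsTypeIAncientMild C (w n) := fun n => isTypeIAncientMild_zoom hA (hlam0 n) _
  have hwcirc : ∀ n r z s, circ (w n) r z s = circ v (lam n * r) (zn n + lam n * z) (lam n ^ 2 * s) := fun n r z s =>
    circ_zoom_axis (lam n) (zn n) v r z s
  have hwR₁ : ∀ n, circ (w n) R₁ 0 (-1) = circ v (R₁ * Real.sqrt (-sn n)) (zn n) (sn n) := by
    intro n
    rw [hwcirc, mul_zero, add_zero, hlam2, mul_comm (lam n) R₁]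
    congr 1
    ring
  have hwle : ∀ n, ∀ σ < 0, ∀ r : ℝ, 0 ≤ r → ∀ z, circ (w n) r z σ ≤ S₀ := by
    intro n σ hσ r hr z
    rw [hwcirc]
    refine hleS _ ?_ _ (mul_nonneg (hlam0 n).le hr) _
    exact mul_neg_of_pos_of_neg (pow_pos (hlam0 n) 2) hσ
  have hwsign : ∀ n, SignE3 (w n) := by
    intro n σ hσ y
    have hcurl : curl (w n σ) y =
        (lam n * lam n) • curl (v (0 + lam n ^ 2 * σ)) (cylPt 0 0 (zn n) + lam n • y) :=
      curl_smul_stPull (lam n) (lam n ^ 2) (lam n) 0 (cylPt 0 0 (zn n)) v σ y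
    rw [hcurl, real_inner_smul_left]
    refine mul_nonneg (mul_self_nonneg _) (hsign _ ?_ _)
    rw [zero_add]; exact mul_neg_of_pos_of_neg (pow_pos (hlam0 n) 2) hσ
  have hwcone : ∀ n, ∀ s < 0, ∀ x, Real.sqrt ((curl (w n s) x 0) ^ 2 + (curl (w n s) x 1) ^ 2) ≤ K * curl (w n s) x 2 :=
    fun n => cone_zoom hcone (hlam0 n) _
  -- compactness
  obtain ⟨φ, hφ, W, hW, hpt, hptG, hlu, -⟩ := exists_tendsto_of_isTypeIAncientMild_seq C hwcl
  have hWdoor : InDoorClass C W := inDoorClass_of_isTypeIAncientMild hW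
  have hWsign : SignE3 W := by
    intro σ hσ y
    have hc : Tendsto (fun j => ⟪curl (w (φ j) σ) y, e3⟫) atTop (𝓝 ⟪curl (W σ) y, e3⟫) :=
      (tendsto_curl_of_tendsto_fderiv (hptG σ hσ y)).inner tendsto_const_nhds
    exact ge_of_tendsto' hc fun j => hwsign (φ j) σ hσ y
  have hWcone : ∀ s < 0, ∀ x, Real.sqrt ((curl (W s) x 0) ^ 2 + (curl (W s) x 1) ^ 2) ≤ K * curl (W s) x 2 :=
    cone_lim (fun j => hwcone (φ j)) hptG
  have hm1 : (-1 : ℝ) < 0 := by norm_num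
  have hclim : ∀ σ < 0, ∀ r z, Tendsto (fun j => circ (w (φ j)) r z σ) atTop (𝓝 (circ W r z σ)) := fun σ hσ r z =>
    tendsto_circ (fun j => (hwcl (φ j)).continuous_slice hσ) (hW.continuous_slice hσ) (hlu σ hσ) r z
  -- the saturated disc of the limit
  have hWR₁ : circ W R₁ 0 (-1) = S₀ := by
    refine tendsto_nhds_unique (hclim (-1) hm1 R₁ 0) ?_
    have hlow : Tendsto (fun j => S₀ - 1 / ((φ j : ℝ) + 1)) atTop (𝓝 S₀) := by
      have h1 : Tendsto (fun j => 1 / ((φ j : ℝ) + 1)) atTop (𝓝 0) := by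
        have hφ' : Tendsto (fun j => ((φ j : ℕ) : ℝ)) atTop atTop :=
          tendsto_natCast_atTop_atTop.comp hφ.tendsto_atTop
        have : Tendsto (fun j => ((φ j : ℝ) + 1)) atTop atTop := tendsto_atTop_add_const_right _ 1 hφ'
        exact tendsto_const_nhds.div_atTop this
      simpa using tendsto_const_nhds.sub h1
    refine tendsto_of_tendsto_of_tendsto_of_le_of_le hlow tendsto_const_nhds (fun j => ?_) fun j => ?_
    · rw [hwR₁]; exact (hp2 (φ j)).le
    · exact hwle (φ j) (-1) hm1 R₁ hR₁0 0
  have hWle : ∀ r : ℝ, 0 ≤ r → ∀ z, circ W r z (-1) ≤ S₀ := fun r hr z =>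
    le_of_tendsto' (hclim (-1) hm1 r z) fun j => hwle (φ j) (-1) hm1 r hr z
  have hW0 := eq_zero_of_saturated hWdoor hWsign hK hWcone hm1 hR₁0 hWR₁ hWle
  have : circ W R₁ 0 (-1) = 0 := circ_eq_zero_of_slice_zero (hW0 (-1) hm1) R₁ 0
  linarith

/-- **Poloidality of the cone stratum** (the `HemisphereLiouvilleE3` conclusion for coned profiles, all `C`, `K`). -/
theorem inner_curl_e3_eq_zero_of_coned (hv : InDoorClass C v) (hsign : SignE3 v) {K : ℝ} (hK : 0 ≤ K)
    (hcone : ∀ s < 0, ∀ x, Real.sqrt ((curl (v s) x 0) ^ 2 + (curl (v s) x 1) ^ 2) ≤ K * curl (v s) x 2) :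
    ∀ s < 0, ∀ y, ⟪curl (v s) y, e3⟫ = 0 := by
  intro s hs y
  have h0 := eq_zero_of_coned hv hsign hK hcone
  have hslice : v s = fun _ => 0 := funext fun x => h0 s hs x
  rw [inner_e3_apply, hslice]
  simp [curl]

/-- **The apex is not backward-singular** (the profile vanishes). -/
theorem not_isBackwardSingularPoint_of_coned (hv : InDoorClass C v) (hsign : SignE3 v) {K : ℝ} (hK : 0 ≤ K)
    (hcone : ∀ s < 0, ∀ x, Real.sqrt ((curl (v s) x 0) ^ 2 + (curl (v s) x 1) ^ 2) ≤ K * curl (v s) x 2) :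
    ¬ IsBackwardSingularPoint v 0 := by
  intro hsing
  have h0 := eq_zero_of_coned hv hsign hK hcone
  have hnorm : eLpNorm (uncurry v) ⊤
      (volume.restrict (parabolicCylinder 1 (0 : ℝ × EuclideanSpace ℝ (Fin 3)))) = 0 := by
    rw [eLpNorm_congr_ae (g := 0) ?_, eLpNorm_zero]
    filter_upwards [ae_restrict_mem (isOpen_parabolicCylinder _ _).measurableSet] with q hq
    have hq0 : q.1 < 0 := by
      rw [mem_parabolicCylinder] at hq
      simpa using hq.1.2
    exact h0 q.1 hq0 q.2
  have htop := hsing 1 one_pos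
  rw [hnorm] at htop
  exact ENNReal.zero_ne_top htop

/-- **LRT's spelling, all `C`**: a door-class profile with `‖ω‖ ≤ K'·⟪ω, e₃⟫` everywhere (`K' ≥ 0`; Lei–Ren–Tian arXiv:2501.08976, Remark 1.2's
single cone, scale-invariant form) vanishes identically — the KNSS time-only analogue of their Theorem 1.1, with no energy hypothesis. -/
theorem eq_zero_of_vorticity_cone_allC (hv : InDoorClass C v) {K' : ℝ} (hK : 0 ≤ K')
    (hcone : ∀ s < 0, ∀ x, ‖curl (v s) x‖ ≤ K' * ⟪curl (v s) x, e3⟫) : ∀ t < 0, ∀ x, v t x = 0 := by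
  have h3 : ∀ s x, |curl (v s) x 2| ≤ ‖curl (v s) x‖ := fun s x => by
    rw [← Real.norm_eq_abs]; exact PiLp.norm_apply_le (curl (v s) x) 2
  have hsign : SignE3 v := fun s hs x => by
    have h := hcone s hs x
    rw [inner_e3_apply] at h ⊢
    by_contra hneg
    push Not at hneg
    have hn : ‖curl (v s) x‖ ≤ 0 := by nlinarith [norm_nonneg (curl (v s) x)]
    have hab := abs_le.1 ((h3 s x).trans hn)
    linarith [hab.1, hab.2]
  refine eq_zero_of_coned hv hsign hK (fun s hs x => ?_)
  have h := hcone s hs x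
  rw [inner_e3_apply] at h
  refine le_trans ?_ h
  have hsq : (curl (v s) x 0) ^ 2 + (curl (v s) x 1) ^ 2 ≤ ‖curl (v s) x‖ ^ 2 :=
    Literature.Analysis.FluidPDE.Wei2016.sq_add_sq_le_norm_sq _
  exact (Real.sqrt_le_sqrt hsq).trans (Real.sqrt_sq (norm_nonneg _)).le

end Summit.NavierStokesRegularity.NavierStokesRegularity.Theorems.HalfSpaceWindowDoorCirculationCarryingRigidityConeLiouville

end
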